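import Mathlib.MeasureTheory.Constructions.HaarToSphere
import Mathlib.MeasureTheory.Measure.Lebesgue.VolumeOfBalls
import Mathlib.MeasureTheory.Integral.IntegralEqImproper
import Mathlib.Analysis.InnerProductSpace.Projection.Reflection
import Mathlib.MeasureTheory.Measure.Haar.InnerProductSpace
import Mathlib.MeasureTheory.Measure.Haar.NormedSpace
import Mathlib.Analysis.SpecialFunctions.Integrals.Basic
import Mathlib.MeasureTheory.Integral.Prod
import Summits.AtomisticToContinuum.Crystallization.Theorems.FrustratedLawDichotomySchurCut

/-!
# FrustratedLawDichotomy · the AUTOCORRELATION PROFILE of the quartic bump in `ℝ³` — `omega₂` IS `(β⋆β)/(β⋆β)(0)` (PROVED)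

Beneath lens-5 g34's Schur tail floors `SF₅ = SchurFloor w₅ ω₅ (13/4000)` / `SF₄₅` / `SF₄` (`…SchurCutB`), the abstract Schur/Bochner step is
PROVED (`…SchurDomination.schurDomination`, hand-1 g12) and radialised into `SchurFloor` shape (`…SchurDominationFloor.pairFloor_of_domination`)
modulo two analytic data: (i) the PROFILE IDENTITY `∫ β(x)β(x − v) dx = c₀·ω(‖v‖)` for the bump `β = (1 − |x|²)₊²` with `ω = omega₂`
(`…SchurCut.omega₂`, lens-5's degree-11 polynomial «computed in exact rational arithmetic, scripts/omega_exact.py»), and (ii) the one-variable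
domination certificate.  THIS FILE PROVES (i):

  `bump_autocorr : ∀ v, ∫ x, bump x * bump (x - v) = 512 * π / 3465 * omega₂ ‖v‖`,  `bump x = (max (1 − ‖x‖²) 0)²`,

so `c₀ = (β⋆β)(0) = ∫ β² = 512π/3465` and `omega₂` is EXACTLY the normalised autocorrelation (all seven coefficients).  Route (elementary,
Mathlib only): §1 one-variable polynomial integrals and the closed form `J A B = ∫_{u>0} (A−u)₊²(B−u)₊² du = D²A³/3 + DA⁴/2 + A⁵/5`
(`0 ≤ A ≤ B`, `D = B − A`); §2 the planar radial integral `∫_{ℝ²} g(A − ‖y‖²)g(B − ‖y‖²) dy = π·J A B` (`integral_fun_norm_addHaar`,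
`volume_ball_fin_two`, substitution `u = ρ²`); §3 the slab decomposition `ℝ³ ≃ᵐ ℝ × ℝ²` (volume preserving; `‖x‖² = t² + ‖y‖²`);
§4 Fubini: `F(r) := ∫ β(x)β(x − r e₀) dx = ∫_ℝ π·J(1 − t², 1 − (t − r)²) dt`; §5 the outer integral: on `[r/2, 1]` the integrand is an explicit
degree-10 polynomial in `t` (coefficients `c₁ r k`), the left piece `[r − 1, r/2]` is its mirror image under `t ↦ r − t`, everything else
vanishes, whence `F(r) = (512π/3465)·omega₂(r)` for `0 ≤ r` (both branches of `omega₂`; the polynomial vanishes at `r = 2`); §6 a general `v` is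
moved to the axis by the reflection `Submodule.reflection_sub` (volume preserving, `β` is radial).

The radius-`a` bump (`∫ β_a(x)β_a(x − v) dx = a³·(512π/3465)·omega₂(‖v‖/a)`; `a = 4/5` serves `ω₄`) and the Schur-floor consequences
(`SF₅` / `SF₄₅` / `SF₄` from a dominator `K` ALONE) are in `…FrustratedLawDichotomyBumpSchurFloor`.
[folklore] (sphere-intersection kinematics / slab integration); 0 sorry.  Prover hand 1, gen 13 (decomp-a2c), `--supports stmt-AtomisticToContinuum-27623`.
-/

noncomputable section

namespace Summit.AtomisticToContinuum.Crystallization.Theorems.FrustratedLawDichotomyBumpAutocorrelation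

open MeasureTheory Set Real
open scoped BigOperators
open Summit.AtomisticToContinuum.Crystallization.Theorems.FrustratedLawDichotomySchurCut (omega₂)

/-! ## §1. One-variable polynomial integrals and the clipped square -/

/-- `∫_a^b Σ_{k<n} c_k x^k = Σ_{k<n} c_k (b^{k+1} − a^{k+1})/(k+1)`. [folklore] -/
theorem integral_poly (c : ℕ → ℝ) (n : ℕ) (a b : ℝ) :
    ∫ x in a..b, ∑ k ∈ Finset.range n, c k * x ^ k = ∑ k ∈ Finset.range n, c k * ((b ^ (k + 1) - a ^ (k + 1)) / (k + 1)) := by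
  rw [intervalIntegral.integral_finsetSum]
  · refine Finset.sum_congr rfl fun k _ => ?_
    rw [intervalIntegral.integral_const_mul, integral_pow]
  · intro k _
    exact (continuous_const.mul (continuous_pow k)).intervalIntegrable _ _

/-- The clipped square `clipSq s = (s₊)² = (max s 0)²`. -/
def clipSq (s : ℝ) : ℝ := (max s 0) ^ 2

/-- `0 ≤ clipSq s`. [folklore] -/
theorem clipSq_nonneg (s : ℝ) : 0 ≤ clipSq s := sq_nonneg _

/-- `clipSq s = 0` for `s ≤ 0`. [folklore] -/
theorem clipSq_of_nonpos {s : ℝ} (h : s ≤ 0) : clipSq s = 0 := by simp [clipSq, max_eq_right h]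

/-- `clipSq s = s²` for `0 ≤ s`. [folklore] -/
theorem clipSq_of_nonneg {s : ℝ} (h : 0 ≤ s) : clipSq s = s ^ 2 := by simp [clipSq, max_eq_left h]

/-- `clipSq` is continuous. [folklore] -/
theorem continuous_clipSq : Continuous clipSq := (continuous_id.max continuous_const).pow 2

/-- `J A B = ∫_{u>0} (A − u)₊² (B − u)₊² du` — the radial kernel of the planar slab integral. -/
def J (A B : ℝ) : ℝ := ∫ u in Ioi 0, clipSq (A - u) * clipSq (B - u)

/-- **Closed form of `J`** for `0 ≤ A ≤ B` (`D = B − A`): `J A B = D²A³/3 + D A⁴/2 + A⁵/5`. [folklore] -/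
theorem J_eq {A B : ℝ} (hA : 0 ≤ A) (hAB : A ≤ B) :
    J A B = (B - A) ^ 2 * A ^ 3 / 3 + (B - A) * A ^ 4 / 2 + A ^ 5 / 5 := by
  unfold J
  rw [setIntegral_eq_of_subset_of_forall_sdiff_eq_zero measurableSet_Ioi (Ioc_subset_Ioi_self : Ioc (0:ℝ) A ⊆ Ioi 0)]
  swap
  · intro u hu
    have hu' : A < u := by
      rcases hu with ⟨h1, h2⟩
      simp only [mem_Ioc, not_and, not_le] at h2
      exact h2 h1
    rw [clipSq_of_nonpos (by linarith), zero_mul]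
  rw [← intervalIntegral.integral_of_le hA]
  have heq : ∀ u ∈ uIcc 0 A, clipSq (A - u) * clipSq (B - u) =
      ∑ k ∈ Finset.range 5, (fun k => if k = 0 then A ^ 2 * B ^ 2 else if k = 1 then -(2 * A * B * (A + B))
        else if k = 2 then A ^ 2 + 4 * A * B + B ^ 2 else if k = 3 then -(2 * (A + B)) else 1) k * u ^ k := by
    intro u hu
    rw [uIcc_of_le hA] at hu
    rw [clipSq_of_nonneg (by linarith [hu.2]), clipSq_of_nonneg (by linarith [hu.2])]
    simp [Finset.sum_range_succ]
    ring
  rw [intervalIntegral.integral_congr heq, integral_poly]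
  simp [Finset.sum_range_succ]
  ring

/-- For `A ≤ 0` the integrand vanishes on `u > 0`: `J A B = 0`. [folklore] -/
theorem J_of_nonpos {A B : ℝ} (hA : A ≤ 0) : J A B = 0 := by
  unfold J
  rw [setIntegral_congr_fun measurableSet_Ioi (fun u (hu : 0 < u) => by rw [clipSq_of_nonpos (by linarith), zero_mul])]
  simp

/-- `J` is symmetric. [folklore] -/
theorem J_comm (A B : ℝ) : J A B = J B A := by
  unfold J; congr 1; funext u; ring

/-! ## §2. The planar radial integral -/

/-- **`∫_{ℝ²} (A − ‖y‖²)₊² (B − ‖y‖²)₊² dy = π · J A B`** (polar coordinates `integral_fun_norm_addHaar`, `vol(B²) = π`, `u = ρ²`). [folklore] -/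
theorem radial2 (A B : ℝ) : ∫ y : (EuclideanSpace ℝ (Fin 2)), clipSq (A - ‖y‖ ^ 2) * clipSq (B - ‖y‖ ^ 2) = π * J A B := by
  have h := MeasureTheory.integral_fun_norm_addHaar (volume : Measure (EuclideanSpace ℝ (Fin 2))) (fun ρ => clipSq (A - ρ ^ 2) * clipSq (B - ρ ^ 2))
  rw [h]
  have hdim : Module.finrank ℝ (EuclideanSpace ℝ (Fin 2)) = 2 := by simp
  rw [hdim]
  have hball : (volume : Measure (EuclideanSpace ℝ (Fin 2))).real (Metric.ball (0:(EuclideanSpace ℝ (Fin 2))) 1) = π := by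
    rw [measureReal_def, EuclideanSpace.volume_ball_fin_two]
    simp [ENNReal.toReal_ofReal Real.pi_pos.le]
  rw [hball]
  have hJ : ∫ y in Ioi (0:ℝ), clipSq (A - y) * clipSq (B - y) = J A B := rfl
  have hsub := integral_comp_rpow_Ioi_of_pos (g := fun u => clipSq (A - u) * clipSq (B - u)) (p := 2) two_pos
  have e : ∫ x in Ioi (0:ℝ), ((2:ℝ) * x ^ ((2:ℝ) - 1)) • (fun u => clipSq (A - u) * clipSq (B - u)) (x ^ (2:ℝ)) =
      2 * ∫ y in Ioi (0:ℝ), y ^ (2 - 1) • (clipSq (A - y ^ 2) * clipSq (B - y ^ 2)) := by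
    rw [← integral_const_mul]
    refine setIntegral_congr_fun measurableSet_Ioi fun x (hx : 0 < x) => ?_
    simp only [smul_eq_mul]
    rw [show (2:ℝ) - 1 = 1 by norm_num, Real.rpow_one, Real.rpow_two]
    ring
  rw [e, hJ] at hsub
  simp only [nsmul_eq_mul, smul_eq_mul, Nat.cast_ofNat] at hsub ⊢
  linear_combination π * hsub

/-! ## §3. The slab decomposition `ℝ³ ≃ᵐ ℝ × ℝ²` -/

/-- The slab map `x ↦ (x₀, (x₁, x₂))`, a measurable equivalence `ℝ³ ≃ᵐ ℝ × ℝ²`. -/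
def slab : (EuclideanSpace ℝ (Fin 3)) ≃ᵐ ℝ × (EuclideanSpace ℝ (Fin 2)) :=
  (((MeasurableEquiv.toLp 2 (Fin 3 → ℝ)).symm.trans (MeasurableEquiv.piFinSuccAbove (fun _ => ℝ) 0)).trans
    (MeasurableEquiv.prodCongr (MeasurableEquiv.refl ℝ) (MeasurableEquiv.toLp 2 (Fin 2 → ℝ))))

/-- The slab map is volume preserving. [folklore] -/
theorem measurePreserving_slab : MeasurePreserving slab volume volume := by
  refine ((EuclideanSpace.volume_preserving_symm_measurableEquiv_toLp (Fin 3)).trans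
    (volume_preserving_piFinSuccAbove (fun _ => ℝ) 0)).trans ?_
  exact (MeasurePreserving.id volume).prod (PiLp.volume_preserving_toLp (Fin 2))

/-- The inverse slab map in coordinates. [folklore] -/
theorem slab_symm_eq (t : ℝ) (y : (EuclideanSpace ℝ (Fin 2))) : slab.symm (t, y) = WithLp.toLp 2 (Fin.insertNth 0 t (WithLp.ofLp y)) := rfl

/-- Coordinate `0` of `slab⁻¹(t, y)` is `t`. [folklore] -/
theorem slab_symm_apply_zero (t : ℝ) (y : (EuclideanSpace ℝ (Fin 2))) : (slab.symm (t, y)) 0 = t := by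
  simp [slab_symm_eq]

/-- Coordinate `j+1` of `slab⁻¹(t, y)` is `y j`. [folklore] -/
theorem slab_symm_apply_succ (t : ℝ) (y : (EuclideanSpace ℝ (Fin 2))) (j : Fin 2) : (slab.symm (t, y)) (Fin.succ j) = y j := by
  simp [slab_symm_eq]

/-- The axis unit vector `e₀`. -/
def e0 : (EuclideanSpace ℝ (Fin 3)) := EuclideanSpace.single 0 1

/-- `‖e₀‖ = 1`. [folklore] -/
theorem norm_e0 : ‖e0‖ = 1 := by simp [e0]

/-- `‖slab⁻¹(t, y) − s·e₀‖² = (t − s)² + ‖y‖²`. [folklore] -/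
theorem norm_sq_slab_symm_sub (t s : ℝ) (y : (EuclideanSpace ℝ (Fin 2))) : ‖slab.symm (t, y) - s • e0‖ ^ 2 = (t - s) ^ 2 + ‖y‖ ^ 2 := by
  rw [EuclideanSpace.real_norm_sq_eq, EuclideanSpace.real_norm_sq_eq, Fin.sum_univ_succ]
  congr 1
  · simp [slab_symm_apply_zero, e0]
  · refine Finset.sum_congr rfl fun j _ => ?_
    simp [slab_symm_apply_succ, e0, Fin.succ_ne_zero]

/-- `‖slab⁻¹(t, y)‖² = t² + ‖y‖²`. [folklore] -/
theorem norm_sq_slab_symm (t : ℝ) (y : (EuclideanSpace ℝ (Fin 2))) : ‖slab.symm (t, y)‖ ^ 2 = t ^ 2 + ‖y‖ ^ 2 := by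
  simpa using norm_sq_slab_symm_sub t 0 y

/-! ## §4. The bump, the slab integrand, Fubini -/

/-- **The quartic bump** `β(x) = (1 − ‖x‖²)₊²` on `ℝ³` (lens-5 g34's `β`, un-normalised). -/
def bump (x : (EuclideanSpace ℝ (Fin 3))) : ℝ := clipSq (1 - ‖x‖ ^ 2)

/-- `β` is continuous. [folklore] -/
theorem continuous_bump : Continuous bump :=
  continuous_clipSq.comp (continuous_const.sub (continuous_norm.pow 2))

/-- `β ≥ 0`. [folklore] -/
theorem bump_nonneg (x : (EuclideanSpace ℝ (Fin 3))) : 0 ≤ bump x := clipSq_nonneg _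

/-- `β` vanishes outside the unit ball. [folklore] -/
theorem bump_eq_zero {x : (EuclideanSpace ℝ (Fin 3))} (h : 1 ≤ ‖x‖) : bump x = 0 :=
  clipSq_of_nonpos (by nlinarith [norm_nonneg x])

/-- `β` has compact support. [folklore] -/
theorem hasCompactSupport_bump : HasCompactSupport bump := by
  refine HasCompactSupport.intro (isCompact_closedBall (0 : (EuclideanSpace ℝ (Fin 3))) 1) fun x hx => bump_eq_zero ?_
  rw [Metric.mem_closedBall, dist_zero_right, not_le] at hx
  exact hx.le

/-- `β` is radial: invariant under linear isometries. [folklore] -/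
theorem bump_linearIsometryEquiv (R : (EuclideanSpace ℝ (Fin 3)) ≃ₗᵢ[ℝ] (EuclideanSpace ℝ (Fin 3))) (x : (EuclideanSpace ℝ (Fin 3))) : bump (R x) = bump x := by
  simp [bump]

/-- The slab integrand `(1 − t² − ‖y‖²)₊²·(1 − (t − r)² − ‖y‖²)₊²`. -/
def slabF (r : ℝ) (p : ℝ × (EuclideanSpace ℝ (Fin 2))) : ℝ := clipSq (1 - p.1 ^ 2 - ‖p.2‖ ^ 2) * clipSq (1 - (p.1 - r) ^ 2 - ‖p.2‖ ^ 2)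

/-- `β(x)β(x − r e₀)` in slab coordinates. [folklore] -/
theorem bump_mul_bump_slab_symm (r : ℝ) (p : ℝ × (EuclideanSpace ℝ (Fin 2))) :
    bump (slab.symm p) * bump (slab.symm p - r • e0) = slabF r p := by
  obtain ⟨t, y⟩ := p
  rw [bump, bump, norm_sq_slab_symm, norm_sq_slab_symm_sub, slabF]
  congr 2 <;> ring

/-- The slab integrand is continuous. [folklore] -/
theorem continuous_slabF (r : ℝ) : Continuous (slabF r) := by
  unfold slabF
  exact (continuous_clipSq.comp (by fun_prop)).mul (continuous_clipSq.comp (by fun_prop))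

/-- The slab integrand has compact support (inside the closed unit ball of `ℝ × ℝ²`). [folklore] -/
theorem hasCompactSupport_slabF (r : ℝ) : HasCompactSupport (slabF r) := by
  refine HasCompactSupport.intro (isCompact_closedBall (0 : ℝ × (EuclideanSpace ℝ (Fin 2))) 1) fun p hp => ?_
  rw [Metric.mem_closedBall, dist_zero_right, Prod.norm_def, max_le_iff, not_and_or, Real.norm_eq_abs] at hp
  have hneg : 1 - p.1 ^ 2 - ‖p.2‖ ^ 2 ≤ 0 := by
    rcases hp with h | h
    · rw [not_le] at h
      have : 1 < p.1 ^ 2 := by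
        have h' : 1 < |p.1| := h
        nlinarith [abs_nonneg p.1, sq_abs p.1]
      nlinarith [norm_nonneg p.2]
    · rw [not_le] at h
      nlinarith [norm_nonneg p.2, sq_nonneg p.1]
  simp [slabF, clipSq_of_nonpos hneg]

/-- The slab integrand is integrable. [folklore] -/
theorem integrable_slabF (r : ℝ) : Integrable (slabF r) :=
  (continuous_slabF r).integrable_of_hasCompactSupport (hasCompactSupport_slabF r)

/-- The autocorrelation along the axis: `F(r) = ∫ β(x) β(x − r e₀) dx`. -/
def axisF (r : ℝ) : ℝ := ∫ x, bump x * bump (x - r • e0)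

/-- **Slab formula (Fubini)**: `F(r) = ∫_ℝ π·J(1 − t², 1 − (t − r)²) dt`. [folklore] -/
theorem axisF_eq_integral_J (r : ℝ) : axisF r = ∫ t, π * J (1 - t ^ 2) (1 - (t - r) ^ 2) := by
  have h1 : axisF r = ∫ p, slabF r p := by
    rw [axisF, ← (measurePreserving_slab.symm slab).integral_comp' (fun x => bump x * bump (x - r • e0))]
    simp only [bump_mul_bump_slab_symm]
  rw [h1, MeasureTheory.Measure.volume_eq_prod, integral_prod _ ((MeasureTheory.Measure.volume_eq_prod ℝ (EuclideanSpace ℝ (Fin 2))) ▸ integrable_slabF r)]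
  refine integral_congr_ae (Filter.Eventually.of_forall fun t => ?_)
  show ∫ y : (EuclideanSpace ℝ (Fin 2)), slabF r (t, y) = π * J (1 - t ^ 2) (1 - (t - r) ^ 2)
  simp only [slabF]
  exact radial2 _ _

/-! ## §5. The outer integral: piecewise polynomial bookkeeping -/

/-- Monomial coefficients (in `t`) of `J(1 − t², 1 − (t − r)²)` on the right piece `t ∈ [r/2, 1]` (generated in exact rational arithmetic). -/
def c₁ (r : ℝ) (k : ℕ) : ℝ :=
    if k = 0 then (1/5:ℝ) + (-1/2:ℝ) * r ^ 2 + (1/3:ℝ) * r ^ 4 else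
    if k = 1 then (1:ℝ) * r + (-4/3:ℝ) * r ^ 3 else
    if k = 2 then (-1:ℝ) + (10/3:ℝ) * r ^ 2 + (-1:ℝ) * r ^ 4 else
    if k = 3 then (-4:ℝ) * r + (4:ℝ) * r ^ 3 else
    if k = 4 then (2:ℝ) + (-7:ℝ) * r ^ 2 + (1:ℝ) * r ^ 4 else
    if k = 5 then (6:ℝ) * r + (-4:ℝ) * r ^ 3 else
    if k = 6 then (-2:ℝ) + (6:ℝ) * r ^ 2 + (-1/3:ℝ) * r ^ 4 else
    if k = 7 then (-4:ℝ) * r + (4/3:ℝ) * r ^ 3 else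
    if k = 8 then (1:ℝ) + (-11/6:ℝ) * r ^ 2 else
    if k = 9 then (1:ℝ) * r else
    if k = 10 then (-1/5:ℝ) else
    0

/-- On the right piece `r/2 ≤ t ≤ 1` (`r ≥ 0`), `J(1 − t², 1 − (t − r)²)` is the explicit degree-10 polynomial `Σ_k c₁ r k · t^k`. [folklore] -/
theorem J_axis_right {r t : ℝ} (hr : 0 ≤ r) (h1 : r / 2 ≤ t) (h2 : t ≤ 1) :
    J (1 - t ^ 2) (1 - (t - r) ^ 2) = ∑ k ∈ Finset.range 11, c₁ r k * t ^ k := by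
  rw [J_eq (by nlinarith) (by nlinarith)]
  simp [Finset.sum_range_succ, c₁]
  ring

/-- The reflection `t ↦ r − t` swaps the two factors of the integrand. [folklore] -/
theorem J_axis_reflect (r t : ℝ) : J (1 - t ^ 2) (1 - (t - r) ^ 2) = J (1 - (r - t) ^ 2) (1 - ((r - t) - r) ^ 2) := by
  rw [J_comm]; congr 1 <;> ring

/-- The integrand vanishes for `t > 1`. [folklore] -/
theorem J_axis_zero_of_one_lt {r t : ℝ} (h : 1 < t) : J (1 - t ^ 2) (1 - (t - r) ^ 2) = 0 :=
  J_of_nonpos (by nlinarith)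

/-- The integrand vanishes for `t ≤ r − 1`. [folklore] -/
theorem J_axis_zero_of_le {r t : ℝ} (h : t ≤ r - 1) : J (1 - t ^ 2) (1 - (t - r) ^ 2) = 0 := by
  rw [J_comm]; exact J_of_nonpos (by nlinarith)

/-- Half the profile: `I₁(r) = ∫_{r/2}^1 J(1 − t², 1 − (t − r)²) dt` in closed form (`2·I₁ = (512/3465)·omega₂`). -/
def I₁ (r : ℝ) : ℝ :=
  256 / 3465 - 128 / 945 * r ^ 2 + 16 / 105 * r ^ 4 - 4 / 45 * r ^ 5 + 1 / 105 * r ^ 7 - 1 / 1260 * r ^ 9 + 1 / 33264 * r ^ 11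

/-- The right piece `∫_{r/2}^1 = I₁(r)`. [folklore] -/
theorem integral_right {r : ℝ} (hr : 0 ≤ r) (hr2 : r ≤ 2) :
    ∫ t in (r / 2)..1, J (1 - t ^ 2) (1 - (t - r) ^ 2) = I₁ r := by
  have hle : r / 2 ≤ 1 := by linarith
  rw [intervalIntegral.integral_congr (g := fun t => ∑ k ∈ Finset.range 11, c₁ r k * t ^ k) (fun t ht => by
    rw [uIcc_of_le hle] at ht; exact J_axis_right hr ht.1 ht.2)]
  rw [integral_poly]
  simp [Finset.sum_range_succ, c₁, I₁]
  ring

/-- The left piece `∫_{r−1}^{r/2} = I₁(r)` (mirror image of the right piece under `t ↦ r − t`). [folklore] -/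
theorem integral_left {r : ℝ} (hr : 0 ≤ r) (hr2 : r ≤ 2) :
    ∫ t in (r - 1)..(r / 2), J (1 - t ^ 2) (1 - (t - r) ^ 2) = I₁ r := by
  have h := intervalIntegral.integral_comp_sub_left (fun t => J (1 - t ^ 2) (1 - (t - r) ^ 2)) r (a := r / 2) (b := 1)
  rw [show r - r / 2 = r / 2 by ring] at h
  rw [← h, intervalIntegral.integral_congr (g := fun t => J (1 - t ^ 2) (1 - (t - r) ^ 2)) (fun t _ => (J_axis_reflect r t).symm)]
  exact integral_right hr hr2

/-- Interval integrability on the right piece (it is a polynomial there). [folklore] -/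
theorem intervalIntegrable_right {r : ℝ} (hr : 0 ≤ r) (hr2 : r ≤ 2) :
    IntervalIntegrable (fun t => J (1 - t ^ 2) (1 - (t - r) ^ 2)) volume (r / 2) 1 := by
  have hle : r / 2 ≤ 1 := by linarith
  refine ((intervalIntegrable_congr (g := fun t => ∑ k ∈ Finset.range 11, c₁ r k * t ^ k) ?_).mpr
    ((continuous_finsetSum _ fun k _ => continuous_const.mul (continuous_pow k)).intervalIntegrable _ _))
  intro t ht
  rw [uIoc_of_le hle] at ht
  exact J_axis_right hr ht.1.le ht.2

/-- Interval integrability on the left piece (a polynomial in `r − t` there). [folklore] -/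
theorem intervalIntegrable_left {r : ℝ} (hr : 0 ≤ r) (hr2 : r ≤ 2) :
    IntervalIntegrable (fun t => J (1 - t ^ 2) (1 - (t - r) ^ 2)) volume (r - 1) (r / 2) := by
  have hle : r - 1 ≤ r / 2 := by linarith
  refine ((intervalIntegrable_congr (g := fun t => ∑ k ∈ Finset.range 11, c₁ r k * (r - t) ^ k) ?_).mpr
    ((continuous_finsetSum _ fun k _ => continuous_const.mul ((continuous_const.sub continuous_id).pow k)).intervalIntegrable _ _))
  intro t ht
  rw [uIoc_of_le hle] at ht
  simp only
  rw [J_axis_reflect, J_axis_right hr (by linarith [ht.2]) (by linarith [ht.1])]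

/-- **The outer integral** for `0 ≤ r ≤ 2`: `∫_ℝ J(1 − t², 1 − (t − r)²) dt = 2·I₁(r)`. [folklore] -/
theorem integral_J_axis {r : ℝ} (hr : 0 ≤ r) (hr2 : r ≤ 2) :
    ∫ t, J (1 - t ^ 2) (1 - (t - r) ^ 2) = 2 * I₁ r := by
  rw [← setIntegral_eq_integral_of_forall_compl_eq_zero (s := Ioc (r - 1) 1) (fun t ht => by
    simp only [mem_Ioc, not_and_or, not_lt, not_le] at ht
    rcases ht with h | h
    · exact J_axis_zero_of_le h
    · exact J_axis_zero_of_one_lt h)]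
  rw [← intervalIntegral.integral_of_le (by linarith : r - 1 ≤ 1),
    ← intervalIntegral.integral_add_adjacent_intervals (intervalIntegrable_left hr hr2) (intervalIntegrable_right hr hr2),
    integral_left hr hr2, integral_right hr hr2]
  ring

/-- For `r ≥ 2` the supports are disjoint and the integrand vanishes identically. [folklore] -/
theorem integral_J_axis_of_two_le {r : ℝ} (hr2 : 2 ≤ r) : ∫ t, J (1 - t ^ 2) (1 - (t - r) ^ 2) = 0 := by
  have : ∀ t, J (1 - t ^ 2) (1 - (t - r) ^ 2) = 0 := fun t => by
    rcases le_or_gt t 1 with h | h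
    · exact J_axis_zero_of_le (by linarith)
    · exact J_axis_zero_of_one_lt h
  simp [this]

/-- **The axis profile**: `F(r) = (512π/3465)·omega₂(r)` for `r ≥ 0` (both branches of `omega₂`). [folklore] -/
theorem axisF_eq (r : ℝ) (hr : 0 ≤ r) : axisF r = 512 * π / 3465 * omega₂ r := by
  rw [axisF_eq_integral_J, integral_const_mul]
  rcases lt_or_ge r 2 with h2 | h2
  · rw [integral_J_axis hr h2.le, omega₂, if_pos h2, I₁]
    ring
  · rw [integral_J_axis_of_two_le h2, omega₂, if_neg (not_lt.mpr h2)]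
    ring

/-! ## §6. General `v` by a reflection -/

/-- ★★ **THE AUTOCORRELATION PROFILE OF THE QUARTIC BUMP**: `∫ β(x) β(x − v) dx = (512π/3465)·omega₂(‖v‖)` for every `v ∈ ℝ³` — lens-5 g34's
`omega₂` IS the normalised autocorrelation `(β⋆β)/(β⋆β)(0)` and `(β⋆β)(0) = ∫β² = 512π/3465`. [folklore] -/
theorem bump_autocorr (v : (EuclideanSpace ℝ (Fin 3))) : ∫ x, bump x * bump (x - v) = 512 * π / 3465 * omega₂ ‖v‖ := by
  rw [← axisF_eq ‖v‖ (norm_nonneg v), axisF]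
  set w : (EuclideanSpace ℝ (Fin 3)) := ‖v‖ • e0 with hw_def
  have hw : ‖v‖ = ‖w‖ := by rw [hw_def, norm_smul, norm_e0, mul_one, Real.norm_of_nonneg (norm_nonneg v)]
  by_cases hvw : v = w
  · rw [← hvw]
  · set R : (EuclideanSpace ℝ (Fin 3)) ≃ₗᵢ[ℝ] (EuclideanSpace ℝ (Fin 3)) := ((ℝ ∙ (v - w))ᗮ).reflection with hR_def
    have hRv : R v = w := Submodule.reflection_sub hw
    have hcomp : (fun x => bump x * bump (x - v)) = fun x => (fun z => bump z * bump (z - w)) (R.toHomeomorph.toMeasurableEquiv x) := by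
      funext x
      simp only [Homeomorph.toMeasurableEquiv_coe, LinearIsometryEquiv.coe_toHomeomorph]
      rw [bump_linearIsometryEquiv, ← hRv, ← map_sub, bump_linearIsometryEquiv]
    rw [hcomp]
    have hmp : MeasurePreserving R.toHomeomorph.toMeasurableEquiv volume volume := R.measurePreserving
    exact hmp.integral_comp' (fun z => bump z * bump (z - w))

/-- `∫ β² = 512π/3465`. [folklore] -/
theorem integral_bump_sq : ∫ x, bump x ^ 2 = 512 * π / 3465 := by
  have h := bump_autocorr 0
  simp only [sub_zero, norm_zero, Summit.AtomisticToContinuum.Crystallization.Theorems.FrustratedLawDichotomySchurCut.omega₂_zero,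
    mul_one] at h
  rw [← h]
  exact integral_congr_ae (Filter.Eventually.of_forall fun x => by simp [sq])

end Summit.AtomisticToContinuum.Crystallization.Theorems.FrustratedLawDichotomyBumpAutocorrelation

end
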